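import Mathlib
import HarnessLib
import HarnessLib.Audit
import Summits.AtomisticToContinuum.Statement
import Literature.MathematicalPhysics.QuantumManyBody.PeriodicBoseGas

/-!
Route: BECTorusUnfolding

CLOSED (retired) 2026-08-15T13:41:05Z by operator:999:1257524 — reason: not-a-thesis: assembly does not conclude the sub-problem Statement — note: D-0027 §2.1 audit (human 2026-08-15: routes that do not decide the summit are removed): the assembly concludes `Literature.MathematicalPhysics.QuantumManyBody.BoseGas.BoseEinsteinCondensation`, not the sub-problem statement; a NEW conforming route may be opened from the same idea (generated `closes . The file is kept as the record of this route; refuted decls are indexed as negative knowledge (`ledger negatives`).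

# Route BECTorusUnfolding — finite tori over-condense — torus unfolding is monotone, so
thermodynamic-limit BEC reduces to fixed-range order after the limit

It suffices to show X = TorusUnfolding ∧ FixedRangeOrder for the periodic (torus) problem, plus the
shared boundary-condition
transfer of route BECPeriodicReduction. Write G_Ψ(i,r) := ∫_{cell^N} conj Ψ(X with X_i ↦ X_i + r) ·
Ψ(X) dX for a periodic trial
state Ψ on the torus of side L (so γ̄_Ψ(r) = (N/L³)·G is the translation-averaged one-body density
matrix, G(i,0) = 1, and
n₀(Ψ) = (N/L³)∫_cell G). TorusUnfolding (card torus-unfolding-monotone, V1 on the full cell): at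
fixed density, near-minimisers on
the torus of side 2L = L_{8N} have Re G_{8N}(r) ≤ Re G_N(r) + ε for EVERY displacement r — unfolding
the period can only lose
coherence. FixedRangeOrder (card V3, infinite-volume ODLRO without constructing the limit state):
∃σ>0 such that for every range R,
eventually in N, near-minimisers have Re G_N(r) ≥ σ − ε for ‖r‖∞ ≤ R. Iterating V1 along M_{j+1} =
8M_j turns "thermodynamic limit
first, then r → ∞" into "r up to L/2 at every large N": Re G_N ≥ σ/2 on the whole cell, hence n₀ ≥
(σ/2)N (CoherenceCriterion), i.e.
PeriodicBEC (stmt-0826 verbatim), and BoundaryTransferWeak (stmt-0827, shared) gives the Dirichlet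
conjunct.
Lean: `TorusUnfolding ∧ FixedRangeOrder` (decls of this route; full one-line terms under ## Cruxes;
rc 0 in Sketch.lean together with the term-mode proof of Assembly)

## Assembly
Term-mode glue (proved in Sketch.lean: `fun h1 h2 h3 h4 h5 v hv => h5 v hv ((h4 h1 h2 h3) v hv)`):
UnfoldingToPeriodicBEC applied to
the two cruxes and the criterion yields the PeriodicBEC body for v; BoundaryTransferWeak turns it
into ∃ρ₀ ∀ρ<ρ₀ HasGroundStateBEC v ρ,
which is the conjunct
Literature.MathematicalPhysics.QuantumManyBody.BoseGas.BoseEinsteinCondensation (= Summits'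
BoseEinsteinCondensation, an abbrev).

Rationale: WHY THIS LINE. Mechanism: a one-signed comparison in the DOMAIN (the period of the torus) replaces
every rate/gap estimate — at frozen Bogoliubov
occupations γ̄_L(r) − γ̄_{2L}(r) is an image second-difference sum
Σ_{m∉2ℤ³}[½γ₁^∞(Lm+r)+½γ₁^∞(Lm−r)−γ₁^∞(Lm)] of the infinite-volume
off-diagonal tail γ₁^∞(x) ≍ 1/x², positive on the whole cell because that tail is subharmonic
(Δ|x|⁻² = 2|x|⁻⁴ > 0; lattice sums
computed here: +0.05 A/L² at 0.1L, +0.38 at L/4, +2.4 at L/2 on the axis, +1.9 at the corner), and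
the N(N−1)/2 pair count pushes
the same way (t_N ≈ t_∞(1−1/N)); this is the continuum-boson version of the finite-size lore that
broken-continuous-symmetry ground
states over-order in periodic boxes (HasenfratzNiedermayer1993; quasi-condensates MoraCastin2003)
and of domain monotonicity /
method of images for positive heat kernels (Davies1989). Imported areas: spectral geometry
(heat-kernel comparison, Poisson
summation), finite-size chiral perturbation theory (as heuristic and falsifier), Perron–Frobenius
positivity (LiebSeiringerSolovejYngvason2005 §1.2:
"the kernel γ is positive and, hopefully, translation invariant in the thermodynamic limit"). What
it does that the four open
routes do not: BECInfraredBound/BECPinning/BECRenormGroup/BECPeriodicReduction all fight the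
N-uniformity INSIDE one finite box
(energy windows pay the kinetic gap L⁻²:
Literature.Barriers.AtomisticToContinuum.KineticGapLengthScales); here the uniformity in N
is a comparison between two FINITE systems (TorusUnfolding, decidable by finite-size Bogoliubov and
small computations) and what is
left is FixedRangeOrder — order at fixed distance after the thermodynamic limit, the exactly
stationary setting in which the
point-process / ergodic cards (rigidity-tolerance-dichotomy, palm-hellinger-debye-landscape,
kv-insertion-corrector,
renyi-entropic-delocalisation) work natively and can now attach by signature. Negatives index:
empty.

RANKED CRUXES. #2 TorusUnfolding (crux) — (card V1, full cell) for every repulsive finite-range v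
there is ρ₀>0 such that for 0<ρ<ρ₀, for all large N, for every ε>0 there is δ>0 with: for all
δ-near-minimisers Ψ of the periodic energy on the torus of side L_N=(N/ρ)^{1/3} and Φ on the torus
of side L_{8N} = 2L_N, all particles i, j and every displacement r ∈ ℝ³, Re G_Φ(j,r) ≤ Re G_Ψ(i,r) +
ε (equivalently, for unique ground states: γ̄_{8N,2L}(r) ≤ γ̄_{N,L}(r) pointwise). Rank 2 because it
is the line-defining, cheaply decidable claim. [difficulty: L] (why it might fail: Beyond frozen
Bogoliubov occupations the finite-size shift of the lowest modes n_k(L), |k|=2π/L (occupation ~L/ξ),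
has no proved sign; an O(1) relative shift there cancels the O(γ₁^∞(L)) image margin; wrap-around
few-body effects near ‖r‖∞≈L/2 reversed it for 1D hard rods (card numerics).) [MoraCastin2003,
HasenfratzNiedermayer1993, GiorginiBoronatCasulleras1999, Davies1989, PuleZagrebnov2004,
LiebSeiringerSolovejYngvason2005]
#3 FixedRangeOrder (crux) — (card V3, typed without the limit state) for every repulsive
finite-range v there is ρ₀>0 such that for 0<ρ<ρ₀ there is σ>0 with: for every R, for all large N
(threshold depending on R), for every ε>0 there is δ>0 such that every δ-near-minimiser Ψ on the
torus of side L_N satisfies σ ≤ Re G_Ψ(i,r) + ε for all i and all r with ‖r‖∞ ≤ R — off-diagonal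
long-range order with the thermodynamic limit taken FIRST, uniformly along the sequence (the
residual open problem in its weakest order of limits; the target the infinite-volume cards should
prove). [difficulty: open-problem] (why it might fail: It is T=0 infinite-volume ODLRO for the
interacting continuum gas — open; d=3 is infrared-marginal for any expansion
(BogoliubovPerturbationInfrared), no printed method reaches fixed density (KineticGapLengthScales),
and σ must serve hard cores and every near-minimiser.) [LiebSeiringerSolovejYngvason2005,
PenroseOnsager1956, Fournais2020, Junge2026,
Literature.Barriers.AtomisticToContinuum.BogoliubovPerturbationInfrared,
Literature.Barriers.AtomisticToContinuum.KineticGapLengthScales]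
#4 BoundaryTransferWeak (crux) — (shared verbatim with route BECPeriodicReduction,
stmt-AtomisticToContinuum-0827) for each repulsive finite-range v, constant-mode BEC for periodic
near-minimisers at all small densities implies the conjunct's Dirichlet, mode-free HasGroundStateBEC
v ρ for all small ρ. [difficulty: L] (why it might fail: Dirichlet and periodic ground-state
energies differ by a wall term ≫ the near-minimiser slack N/L², so no energy-comparison proof;
Neumann bracketing must re-localise without re-importing the l⁻² gap; BEC is boundary-condition
sensitive (Robinson, Lauwers–Verbeure–Zagrebnov).) [LiebSeiringerSolovejYngvason2005,
BoccatoSeiringer2023, Junge2026, LauwersVerbeureZagrebnov2003]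
#9 CoherenceCriterion (support) — for L>0 and any periodic trial state Ψ of N particles, a uniform
bound s ≤ Re G_Ψ(i,r) for all i, r gives condensateOccupation N L Ψ ≥ s·N. Proof: n₀ =
N∫_{cell^{N−1}}|L^{-3/2}∫_cell Ψ|² = (N/L³)∫_{r∈cell} G_Ψ(0,r) dr by Fubini and Lℤ³-periodicity in
the first particle; positivity (Perron–Frobenius) is NOT needed in this form. [difficulty:
provable-now] [LiebSeiringerSolovejYngvason2005, Fournais2020]
#9 UnfoldingToPeriodicBEC (support) — TorusUnfolding → FixedRangeOrder → CoherenceCriterion →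
PeriodicBEC (conclusion spelled out = the signature of BECPeriodicReduction.PeriodicBEC, stmt-0826,
so closing this route's cruxes closes 0826 by a one-line theorem). Proof (elementary): fix v, ρ <
min ρ₀, σ from FixedRangeOrder, N ≥ N₀(TorusUnfolding), R := L_N/2; FixedRangeOrder gives N₁(R);
pick k with 8^k N ≥ N₁ and induct downward along M_{j+1} = 8·M_j (definitional, no casts): at each
level choose one min(δ₁,δ₂)-near-minimiser Φ (exists: the constant state inhabits PeriodicTrialState
M L for L>0, and iInf), losing ε/2^j per step; at level N, Re G ≥ σ − ε on ‖r‖∞ ≤ L_N/2, extended to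
all r by periodicity of G in r (pointwise from Ψ.periodic); CoherenceCriterion with s = σ/2 gives c
= σ/2. [difficulty: M] [LiebSeiringerSolovejYngvason2005, Fournais2020]

TWO-LAYER PLAN. TorusUnfolding ⇐ ImageIdentity → RemainderBound → TorusUnfolding, where
ImageIdentity: γ̄_{N,L}(r) − γ̄_{8N,2L}(r) = (image
second-difference sum of the big-torus tail over m ∉ 2ℤ³) + R_N(r), and RemainderBound: |R_N(r)| ≤
half the image term for large N
(finite-size shift of low-mode occupations); OR the path-space split PositiveBridge →
UnfoldingInequality → TorusUnfolding
(ground-state transform / Feynman–Kac representation of G by positive N-body bridge measures on the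
torus; folding 2L → L keeps every
path and adds the odd-winding images). FixedRangeOrder ⇐ LimitCorrelations → LimitODLRO →
FixedRangeOrder (tightness of
near-minimiser correlations along the sequence; ODLRO of the limit object — the entry point for the
Palm / Kipnis–Varadhan /
rigidity cards). BoundaryTransferWeak: as planned in BECPeriodicReduction (Neumann bracketing + a
mode-free criterion). k ≤ 3, depth 1.

KILL CRITERIA. ¬TorusUnfolding with a witness on an open set of displacements at arbitrarily large N
and arbitrarily small ρ (e.g. a
number-conserving finite-size Bogoliubov computation with the wrong sign, made rigorous for some
admissible v): if the witness
lives only in the outer shell ‖r‖∞ > L/4, REPAIR by restating TorusUnfolding on the inner quarter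
and adding the Perron–Frobenius
support item (near-minimiser positivity of Re G) with the (s on inner, −t elsewhere) criterion, c =
σ/16; if it lives at small r
(kinetic-energy density decreasing in N at fixed ρ) close the route `refuted:TorusUnfolding`.
¬FixedRangeOrder for some admissible
v at arbitrarily small ρ refutes infinite-volume ODLRO — closes this route and, physically, the
periodic form of the conjunct
(signal to all BEC routes). ¬BoundaryTransferWeak kills this route and BECPeriodicReduction, not the
conjunct. PeriodicBEC (0826)
proved elsewhere moots ranks 2–3 (close `superseded`); BoundaryTransferWeak proved elsewhere just
closes rank 4.

NOT DECOMPOSED YET. The card's V2 (Dilution3D: condensate fraction non-decreasing in L at fixed N in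
d=3, collapsing ∀ρ<ρ₀ to one density) is NOT filed:
it is not load-bearing here and its weak implication form is satisfiable vacuously as worded on the
card; it stays a candidate
support statement after 3D N=2 numerics. Also left for layer 2: the Perron–Frobenius/uniqueness
input (only needed after an
outer-shell repair; for hard cores uniqueness on the torus needs caged components of the hard-sphere
configuration space to lie
strictly above E₀ — BaryshnikovBubenikKahle2013, DiaconisLebeauMichel2010), existence of exact C¹
minimisers (never used: every
statement is in ε–δ near-minimiser form, equivalent to the ground-state inequality when the ground
state is unique), the value
σ(ρ) → 1 − O(√(ρa³)), Dirichlet/Neumann variants of unfolding (Dirichlet boxes UNDER-condense: wrong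
direction, audit-4), and any
rate in N.

CHEAPEST FALSIFIER. Second-order, number-conserving finite-size Bogoliubov theory on the cubic torus
(MoraCastin2003-type): the sign of
γ̄_{N,L}(r) − γ̄_{8N,2L}(r) over the cell at ρa³ ∈ [10⁻⁵, 10⁻²], in particular the finite-size shift
of n_k at |k| = 2π/L against
the image margin, and the sign of t(8N,ρ) − t(N,ρ) (kinetic energy density; frozen level: +, pair
count N(N−1)/2: +). Run here at
frozen occupations (python, lattice second-difference sums of |x|⁻² over |m|≤14): γ̄_L − γ_∞
positive on the whole cell (+0.054, +0.385,
+2.42 at 0.1L, L/4, L/2 on the axis; +0.79 at (L/4)(1,1,1); +1.91 at the corner; units A/L² with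
γ₁^∞(x) ≈ A/x²), and the
L-versus-2L margin S(u) − S(u/2)/4 positive on a 6³ grid of u = r/L ∈ [0,½]³ (min +0.050 at u =
(0.1,0,0), i.e. ≈ (15/16)κ|u|²; max +2.30 at (½,0,0)). Second check:
raw PIGS/DMC condensate fractions n₀(N)/N at fixed ρa³ = 10⁻⁴…10⁻² must DEcrease with N
(GiorginiBoronatCasulleras1999 and successors).

NUMBERS. Bogoliubov depletion 1 − n₀/N = (8/(3√π))√(ρa³) + … (LiebSeiringerSolovejYngvason2005 Ch. 5
discussion; DMC GiorginiBoronatCasulleras1999: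
universal in ρa³ up to ~10⁻³), so σ(ρ) can be any number < 1 for ρ small; infinite-volume tail
γ_∞(r) − ρ₀ ≍ m c/(ħ r²)-type 1/r²
decay at T=0, d=3 (subharmonic: Δr⁻² = 2r⁻⁴); image margins above; kinetic-energy density t(N,ρ) ≈
t_∞(ρ)(1 − 1/N) from the pair
count. Items at open: 6 (3 cruxes, 2 support, 1 assembly).

DEFINITION REQUESTS. None needed: everything is inlined over
Literature.MathematicalPhysics.QuantumManyBody.BoseGas.{PeriodicTrialState, periodicEnergy,
periodicGroundStateEnergy, cellN, sideLength, condensateOccupation, IsRepulsiveFiniteRange,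
HasGroundStateBEC, BoseEinsteinCondensation}
(lean search --decl: all present in PeriodicBoseGas.lean / BoseEinsteinCondensation.lean). A
convenience notion
`translationCorrelation N L Ψ i r := ∫ X in cellN N L, conj (Ψ (update X i (X i + r))) * Ψ X` in
PeriodicBoseGas would shorten
every signature; not requested now to avoid signature churn.

Novelty: Searches (2026-08-15): `lit search --hybrid "finite size one-body density matrix periodic box
condensate fraction Bogoliubov
quasi-condensate"` (12 textbook hits, LSSY2005 pp. 8, 35 used); `lit search --source crossref
"Bose-Einstein condensation finite size
scaling ground state"` (15, none relevant); `--source zbmath` ×2 ("Bose condensate finite size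
density matrix periodic", "off-diagonal
long-range order condensate thermodynamic limit finite volume Bose": 0, 0); openalex/s2/arxiv HTTP
429 this pass; `lit vsearch` (finite
periodic box over-ordering: generic finite-size-scaling books only); `lit galaxy search --star all`
×2 and `--star pdf`/`panama` ×2
(0 rows, service saturated); `lit frontier AtomisticToContinuum --since 2020` (BEC descendants
arXiv:2603.20776, arXiv:2510.20493,
arXiv:2602.16566 — none on volume monotonicity); `lit bridges AtomisticToContinuum --cross any` (no
Bose bridge); plus the card's two
refuter audits (audit-4, audit-14) whose finds are adopted.
Nearest prior art found: MoraCastin2003 and doi:10.1103/PhysRevLett.85.3745 (finite periodic boxes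
over-condense at Bogoliubov level,
quasi-condensates); HasenfratzNiedermayer1993 (finite-torus order parameter of a
broken-continuous-symmetry ground state approaches its
limit from ABOVE, m²(L) = m² + c/L, asymptotics not an inequality); GiorginiBoronatCasulleras1999
(DMC n₀ vs ρa³); Davies1989 (domain
monotonicity / images for positive heat kernels); PuleZagrebnov2004 (shape dependence of
condensation, why cu  [refs: 10.1103/PhysRevLett.85.3745, 2603.20776, 2510.20493, 2602.16566, doi:10.1103/PhysRevLett.85.3745, LSSY2005, MoraCastin2003, HasenfratzNiedermayer1993, GiorginiBoronatCasulleras1999, Davies1989, PuleZagrebnov2004]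

Barriers (technique_class: domain-monotonicity, correlation-inequality, odlro-reduction): - technique_class: domain-monotonicity, correlation-inequality, odlro-reduction
- Literature.Barriers.AtomisticToContinuum.KineticGapLengthScales: evaded — no energy window or
kinetic gap is used anywhere; the N-uniformity comes from a one-signed comparison between two finite
tori and FixedRangeOrder takes the thermodynamic limit first; the barrier returns only if a prover
attacks FixedRangeOrder by energy localisation.
- Literature.Barriers.AtomisticToContinuum.EnergyAsymptoticsWithoutCondensation: evaded — no energy
asymptotics enter; the pair-count remark t(N) ≈ t_∞(1−1/N) is heuristic support for the sign, not an
input.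
- Literature.Barriers.AtomisticToContinuum.BogoliubovPerturbationInfrared: it does not, for
FixedRangeOrder, if that crux is attacked by expansion around Bogoliubov (d=3 marginal); the bet is
a non-perturbative infinite-volume engine (Palm / Kipnis–Varadhan / rigidity cards); for
TorusUnfolding Bogoliubov theory is only the heuristic and the falsifier, the intended proofs are
image identities or path unfolding.
- Literature.Barriers.AtomisticToContinuum.CasimirBoxGeneralizedCondensation: outside scope — cubes
along the isotropic sequence, T=0, and for a positive translation-averaged kernel the zero mode
dominates every plane wave (n₀ = ∫γ̄ ≥ |∫γ̄e^{ikr}| = n_k), so type II/III loopholes do not arise;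
no claim is made for anisotropic boxes, where unfolding one edge is expected to fail.
- Literature.Barriers.AtomisticToContinuum.OneDimensionalHardCore: respe

History (route lifecycle, newest last):
- 2026-08-15T13:41:05Z · CLOSED retired — not-a-thesis: assembly does not conclude the sub-problem Statement (operator:999:1257524)

sub-problem: BoseEinsteinCondensation · status: closed(retired) · opened planner-plancard-AtomisticToContinuum-BoseEin-c777413f-0 2026-08-15T11:33:45Z · rev 0 · ledger route-AtomisticToContinuum-BECTorusUnfolding
GENERATED by the gate from the ledger (D-0016/17). Provers cite these decls: `theorem foo : Summit.AtomisticToContinuum.BoseEinsteinCondensation.Theses.BECTorusUnfolding.<Decl> := …` in Summits/AtomisticToContinuum/BoseEinsteinCondensation/Theorems/<Name>.lean.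
-/

namespace Summit.AtomisticToContinuum.BoseEinsteinCondensation.Theses.BECTorusUnfolding

open scoped BigOperators Topology Manifold Classical MeasureTheory ProbabilityTheory Matrix InnerProductSpace ComplexConjugate ContinuousMap
open Filter Set Function TopologicalSpace MeasureTheory

attribute [summit_statement] _root_.BoseEinsteinCondensation

/-- item stmt-AtomisticToContinuum-4436 · crux · rank 2 · closed · moot by None · by planner
why it might fail: Beyond frozen Bogoliubov occupations the finite-size shift of the lowest modes n_k(L), |k|=2π/L (occupation ~L/ξ), has no proved sign; an O(1) relative shift there cancels the O(γ₁^∞(L)) image margin; wrap-around few-body effects near ‖r‖∞≈L/2 reversed it for 1D hard rods (card numerics).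
sources: MoraCastin2003, HasenfratzNiedermayer1993, GiorginiBoronatCasulleras1999, Davies1989, PuleZagrebnov2004, LiebSeiringerSolovejYngvason2005
[crux] (card V1, full cell) for every repulsive finite-range v there is ρ₀>0 such that for 0<ρ<ρ₀,
for all large N, for every ε>0 there is δ>0 with: for all δ-near-minimisers Ψ of the periodic energy
on the torus of side L_N=(N/ρ)^{1/3} and Φ on the torus of side L_{8N} = 2L_N, all particles i, j
and every displacement r ∈ ℝ³, Re G_Φ(j,r) ≤ Re G_Ψ(i,r) + ε (equivalently, for unique ground
states: γ̄_{8N,2L}(r) ≤ γ̄_{N,L}(r) pointwise). Rank 2 because it is the line-defining, cheaply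
decidable claim. [difficulty: L] -/
@[route_item "route-AtomisticToContinuum-BECTorusUnfolding"]
def TorusUnfolding : Prop :=
  ∀ v : ℝ → ENNReal, Literature.MathematicalPhysics.QuantumManyBody.BoseGas.IsRepulsiveFiniteRange v → ∃ ρ₀ : ℝ, 0 < ρ₀ ∧ ∀ ρ : ℝ, 0 < ρ → ρ < ρ₀ → ∀ᶠ N : ℕ in Filter.atTop, ∀ ε : ℝ, 0 < ε → ∃ δ : ENNReal, 0 < δ ∧ ∀ (Ψ : Literature.MathematicalPhysics.QuantumManyBody.BoseGas.PeriodicTrialState N (Literature.MathematicalPhysics.QuantumManyBody.BoseGas.sideLength ρ N)) (Φ : Literature.MathematicalPhysics.QuantumManyBody.BoseGas.PeriodicTrialState (8 * N) (Literature.MathematicalPhysics.QuantumManyBody.BoseGas.sideLength ρ (8 * N))), Literature.MathematicalPhysics.QuantumManyBody.BoseGas.periodicEnergy v Ψ ≤ Literature.MathematicalPhysics.QuantumManyBody.BoseGas.periodicGroundStateEnergy v N (Literature.MathematicalPhysics.QuantumManyBody.BoseGas.sideLength ρ N) + δ → Literature.MathematicalPhysics.QuantumManyBody.BoseGas.periodicEnergy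 v Φ ≤ Literature.MathematicalPhysics.QuantumManyBody.BoseGas.periodicGroundStateEnergy v (8 * N) (Literature.MathematicalPhysics.QuantumManyBody.BoseGas.sideLength ρ (8 * N)) + δ → ∀ (i : Fin N) (j : Fin (8 * N)) (r : EuclideanSpace ℝ (Fin 3)), (∫ X in Literature.MathematicalPhysics.QuantumManyBody.BoseGas.cellN (8 * N) (Literature.MathematicalPhysics.QuantumManyBody.BoseGas.sideLength ρ (8 * N)), conj (Φ.ψ (Function.update X j (X j + r))) * Φ.ψ X).re ≤ (∫ X in Literature.MathematicalPhysics.QuantumManyBody.BoseGas.cellN N (Literature.MathematicalPhysics.QuantumManyBody.BoseGas.sideLength ρ N), conj (Ψ.ψ (Function.update X i (X i + r))) * Ψ.ψ X).re + ε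

/-- item stmt-AtomisticToContinuum-4437 · crux · rank 3 · closed · moot by None · by planner
why it might fail: It is T=0 infinite-volume ODLRO for the interacting continuum gas — open; d=3 is infrared-marginal for any expansion (BogoliubovPerturbationInfrared), no printed method reaches fixed density (KineticGapLengthScales), and σ must serve hard cores and every near-minimiser.
sources: LiebSeiringerSolovejYngvason2005, PenroseOnsager1956, Fournais2020, Junge2026, Literature.Barriers.AtomisticToContinuum.BogoliubovPerturbationInfrared, Literature.Barriers.AtomisticToContinuum.KineticGapLengthScales
[crux] (card V3, typed without the limit state) for every repulsive finite-range v there is ρ₀>0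
such that for 0<ρ<ρ₀ there is σ>0 with: for every R, for all large N (threshold depending on R), for
every ε>0 there is δ>0 such that every δ-near-minimiser Ψ on the torus of side L_N satisfies σ ≤ Re
G_Ψ(i,r) + ε for all i and all r with ‖r‖∞ ≤ R — off-diagonal long-range order with the
thermodynamic limit taken FIRST, uniformly along the sequence (the residual open problem in its
weakest order of limits; the target the infinite-volume cards should prove). [difficulty:
open-problem] -/
@[route_item "route-AtomisticToContinuum-BECTorusUnfolding"]
def FixedRangeOrder : Prop :=
  ∀ v : ℝ → ENNReal, Literature.MathematicalPhysics.QuantumManyBody.BoseGas.IsRepulsiveFiniteRange v → ∃ ρ₀ : ℝ, 0 < ρ₀ ∧ ∀ ρ : ℝ, 0 < ρ → ρ < ρ₀ → ∃ σ : ℝ, 0 < σ ∧ ∀ R : ℝ, ∀ᶠ N : ℕ in Filter.atTop, ∀ ε : ℝ, 0 < ε → ∃ δ : ENNReal, 0 < δ ∧ ∀ Ψ : Literature.MathematicalPhysics.QuantumManyBody.BoseGas.PeriodicTrialState N (Literature.MathematicalPhysics.QuantumManyBody.BoseGas.sideLength ρ N), Literature.MathematicalPhysics.QuantumManyBody.BoseGas.periodicEnergy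 v Ψ ≤ Literature.MathematicalPhysics.QuantumManyBody.BoseGas.periodicGroundStateEnergy v N (Literature.MathematicalPhysics.QuantumManyBody.BoseGas.sideLength ρ N) + δ → ∀ (i : Fin N) (r : EuclideanSpace ℝ (Fin 3)), (∀ k : Fin 3, |r k| ≤ R) → σ ≤ (∫ X in Literature.MathematicalPhysics.QuantumManyBody.BoseGas.cellN N (Literature.MathematicalPhysics.QuantumManyBody.BoseGas.sideLength ρ N), conj (Ψ.ψ (Function.update X i (X i + r))) * Ψ.ψ X).re + ε

/-- item stmt-AtomisticToContinuum-0827 · crux · rank 4 · open · by planner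
why it might fail: Dirichlet and periodic ground-state energies differ by a wall term ≫ the near-minimiser slack N/L², so no energy-comparison proof; Neumann bracketing must re-localise without re-importing the l⁻² gap; BEC is boundary-condition sensitive (Robinson, Lauwers–Verbeure–Zagrebnov).
sources: LiebSeiringerSolovejYngvason2005, BoccatoSeiringer2023, Junge2026, LauwersVerbeureZagrebnov2003
[crux] BoundaryTransferWeak (mode-free boundary-condition transfer, per potential): for each
repulsive finite-range v, PeriodicBEC(v) implies ∃ρ₀>0 ∀ρ∈(0,ρ₀) HasGroundStateBEC v ρ (Dirichlet
ground state, λ_max(γ) ≥ cN via condensateNumber). Not glue: near-minimiser slacks are O(N/L²) while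
Dirichlet/periodic energies differ by a boundary term ≫ N/L², so no energy-comparison proof;
expected route: Neumann bracketing of interior sub-boxes (−Δ_Dir ≥ ⊕−Δ_Neu, v ≥ 0) + a mode-free
criterion (λ_max ≥ tr γ²/N). Only the ENERGY analogue is in print (LiebSeiringerSolovejYngvason2005
Ch. 2 after (2.8)). v ≡ 0: hypothesis and conclusion both true. -/
@[route_item "route-AtomisticToContinuum-BECTorusUnfolding"]
def BoundaryTransferWeak : Prop :=
  ∀ v : ℝ → ENNReal, Literature.MathematicalPhysics.QuantumManyBody.BoseGas.IsRepulsiveFiniteRange v → (∃ ρ₀ : ℝ, 0 < ρ₀ ∧ ∀ ρ : ℝ, 0 < ρ → ρ < ρ₀ → ∃ c : ℝ, 0 < c ∧ ∀ᶠ N : ℕ in Filter.atTop, ∃ δ : ENNReal, 0 < δ ∧ ∀ Ψ : Literature.MathematicalPhysics.QuantumManyBody.BoseGas.PeriodicTrialState N (Literature.MathematicalPhysics.QuantumManyBody.BoseGas.sideLength ρ N), Literature.MathematicalPhysics.QuantumManyBody.BoseGas.periodicEnergy v Ψ ≤ Literature.MathematicalPhysics.QuantumManyBody.BoseGas.periodicGroundStateEnergy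 v N (Literature.MathematicalPhysics.QuantumManyBody.BoseGas.sideLength ρ N) + δ → ENNReal.ofReal (c * N) ≤ Literature.MathematicalPhysics.QuantumManyBody.BoseGas.condensateOccupation N (Literature.MathematicalPhysics.QuantumManyBody.BoseGas.sideLength ρ N) Ψ.ψ) → ∃ ρ₀ : ℝ, 0 < ρ₀ ∧ ∀ ρ : ℝ, 0 < ρ → ρ < ρ₀ → Literature.MathematicalPhysics.QuantumManyBody.BoseGas.HasGroundStateBEC v ρ

/-- item stmt-AtomisticToContinuum-4438 · support · rank 9 · closed · moot by None · by planner
sources: LiebSeiringerSolovejYngvason2005, Fournais2020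
[support] for L>0 and any periodic trial state Ψ of N particles, a uniform bound s ≤ Re G_Ψ(i,r) for
all i, r gives condensateOccupation N L Ψ ≥ s·N. Proof: n₀ = N∫_{cell^{N−1}}|L^{-3/2}∫_cell Ψ|² =
(N/L³)∫_{r∈cell} G_Ψ(0,r) dr by Fubini and Lℤ³-periodicity in the first particle; positivity
(Perron–Frobenius) is NOT needed in this form. [difficulty: provable-now] -/
@[route_item "route-AtomisticToContinuum-BECTorusUnfolding"]
def CoherenceCriterion : Prop :=
  ∀ (N : ℕ) (L s : ℝ), 0 < L → ∀ Ψ : Literature.MathematicalPhysics.QuantumManyBody.BoseGas.PeriodicTrialState N L, (∀ (i : Fin N) (r : EuclideanSpace ℝ (Fin 3)), s ≤ (∫ X in Literature.MathematicalPhysics.QuantumManyBody.BoseGas.cellN N L, conj (Ψ.ψ (Function.update X i (X i + r))) * Ψ.ψ X).re) → ENNReal.ofReal (s * N) ≤ Literature.MathematicalPhysics.QuantumManyBody.BoseGas.condensateOccupation N L Ψ.ψ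

/-- item stmt-AtomisticToContinuum-4439 · support · rank 9 · closed · moot by None · by planner
sources: LiebSeiringerSolovejYngvason2005, Fournais2020
[support] TorusUnfolding → FixedRangeOrder → CoherenceCriterion → PeriodicBEC (conclusion spelled
out = the signature of BECPeriodicReduction.PeriodicBEC, stmt-0826, so closing this route's cruxes
closes 0826 by a one-line theorem). Proof (elementary): fix v, ρ < min ρ₀, σ from FixedRangeOrder, N
≥ N₀(TorusUnfolding), R := L_N/2; FixedRangeOrder gives N₁(R); pick k with 8^k N ≥ N₁ and induct
downward along M_{j+1} = 8·M_j (definitional, no casts): at each level choose one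
min(δ₁,δ₂)-near-minimiser Φ (exists: the constant state inhabits PeriodicTrialState M L for L>0, and
iInf), losing ε/2^j per step; at level N, Re G ≥ σ − ε on ‖r‖∞ ≤ L_N/2, extended to all r by
periodicity of G in r (pointwise from Ψ.periodic); CoherenceCriterion with s = σ/2 gives c = σ/2.
[difficulty: M] -/
@[route_item "route-AtomisticToContinuum-BECTorusUnfolding"]
def UnfoldingToPeriodicBEC : Prop :=
  TorusUnfolding → FixedRangeOrder → CoherenceCriterion → ∀ v : ℝ → ENNReal, Literature.MathematicalPhysics.QuantumManyBody.BoseGas.IsRepulsiveFiniteRange v → ∃ ρ₀ : ℝ, 0 < ρ₀ ∧ ∀ ρ : ℝ, 0 < ρ → ρ < ρ₀ → ∃ c : ℝ, 0 < c ∧ ∀ᶠ N : ℕ in Filter.atTop, ∃ δ : ENNReal, 0 < δ ∧ ∀ Ψ : Literature.MathematicalPhysics.QuantumManyBody.BoseGas.PeriodicTrialState N (Literature.MathematicalPhysics.QuantumManyBody.BoseGas.sideLength ρ N), Literature.MathematicalPhysics.QuantumManyBody.BoseGas.periodicEnergy v Ψ ≤ Literature.MathematicalPhysics.QuantumManyBody.BoseGas.periodicGroundStateEnergy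 v N (Literature.MathematicalPhysics.QuantumManyBody.BoseGas.sideLength ρ N) + δ → ENNReal.ofReal (c * N) ≤ Literature.MathematicalPhysics.QuantumManyBody.BoseGas.condensateOccupation N (Literature.MathematicalPhysics.QuantumManyBody.BoseGas.sideLength ρ N) Ψ.ψ

/-- item stmt-AtomisticToContinuum-4440 · assembly · rank 1 · closed · moot by None · by planner
sources: LiebSeiringerSolovejYngvason2005, PenroseOnsager1956
[assembly] TorusUnfolding → FixedRangeOrder → CoherenceCriterion → UnfoldingToPeriodicBEC →
BoundaryTransferWeak → BoseEinsteinCondensation. -/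
@[route_item "route-AtomisticToContinuum-BECTorusUnfolding"]
def Assembly : Prop :=
  TorusUnfolding → FixedRangeOrder → CoherenceCriterion → UnfoldingToPeriodicBEC → BoundaryTransferWeak → Literature.MathematicalPhysics.QuantumManyBody.BoseGas.BoseEinsteinCondensation

end Summit.AtomisticToContinuum.BoseEinsteinCondensation.Theses.BECTorusUnfolding
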